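import Mathlib
import Summits.Ventures.HodgeRepro2.T5CyclotomicSubfieldRealSubfieldEquiv
import Summits.Ventures.HodgeRepro2.T5CyclotomicSubfieldUnderDegree

/-!
# THE PLACES OF `F⁺` TRANSPORTED TO `realSubfield`: `f(v/p) = ord(p · ⟨H_F, −1⟩)` FOR THE CELL'S OWN PLACES

Tier-5 support N2 / N3 / §G-N4.2 (seat p3, gen 82). The cell's statements about the record's local pair live on
`v : HeightOneSpectrum (𝓞 (maximalRealSubfield F))`; file 308 reads the residue degree of a prime of `F⁺` above
`p ∤ m` as `ord(p · ⟨H_F, −1⟩)` on the intermediate field `realSubfield L F ⊆ ℚ(ζₘ)`. This file transports the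
places along file 309's isomorphism `maximalRealSubfield F ≃ realSubfield L F` (Mathlib's
`RingOfIntegers.mapRingEquiv`, `inertiaDeg'_map_eq`, `inertiaDeg'_eq_inertiaDeg`):

* `integersEquiv`, `integersAlgEquiv` — `𝓞_{F⁺} ≃ 𝓞_{realSubfield}` as rings and as `ℤ`-algebras;
* `transportPlace v` — the image place; `liesOver_transportPlace` (it lies over `(p)` when `v` does);
  **`inertiaDeg_transportPlace`**: `f(transportPlace v / p) = f(v/p)`;
* **`inertiaDeg_eq_orderOf_mk_sup`**: `f(v/p) = ord(p · ⟨H_F, −1⟩)` for every place `v` of `maximalRealSubfield F`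
  above `p ∤ m` — ONE formula, for the cell's own places; **`absNorm_eq_pow_orderOf_mk_sup`**: `N(v) = p^{f}`, the
  `q` of the record's local pair;
* **`orderOf_mk_sup_eq`**: the group-theoretic dictionary between the two readings, proved through number theory —
  `ord(p · ⟨H_F, −1⟩) = ord(p · H_F) / 2` if `(−1) · H_F ∈ ⟨p · H_F⟩`, `= ord(p · H_F)` otherwise (file 300).

§8(d): uses an L-value-free non-vanishing device: NO.
-/

open NumberField NumberField.IsCMField IsCyclotomicExtension.Rat Ideal IsDedekindDomain
  IsDedekindDomain.HeightOneSpectrum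
open Summit.Ventures.HodgeRepro2.T5CMTypeGaloisDialect Summit.Ventures.HodgeRepro2.T5CyclotomicSubfieldInertiaDeg
  Summit.Ventures.HodgeRepro2.T5CyclotomicConjugation Summit.Ventures.HodgeRepro2.T5CyclotomicSubfieldCyclicInert
  Summit.Ventures.HodgeRepro2.T5CyclotomicSubfieldRealSubfield
  Summit.Ventures.HodgeRepro2.T5CyclotomicSubfieldRealSubfieldEquiv
  Summit.Ventures.HodgeRepro2.T5CyclotomicSubfieldUnderDegree

namespace Summit.Ventures.HodgeRepro2.T5CyclotomicSubfieldRealSubfieldPlaces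

section Transport

variable (L : Type*) [Field L] [NumberField L] [IsCMField L] [IsGalois ℚ L]
  (F : IntermediateField ℚ L) [IsCMField F] [Normal ℚ F]

/-- **`𝓞_{F⁺} ≃+* 𝓞_{realSubfield}`** (Mathlib's `RingOfIntegers.mapRingEquiv` on file 309's isomorphism). -/
noncomputable def integersEquiv : 𝓞 (maximalRealSubfield F) ≃+* 𝓞 (realSubfield L F) :=
  RingOfIntegers.mapRingEquiv (realSubfieldEquiv L F)

/-- The same as a `ℤ`-algebra isomorphism (a ring isomorphism is `ℤ`-linear). -/
noncomputable def integersAlgEquiv : 𝓞 (maximalRealSubfield F) ≃ₐ[ℤ] 𝓞 (realSubfield L F) :=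
  AlgEquiv.ofRingEquiv (f := integersEquiv L F) fun n => by
    rw [algebraMap_int_eq, algebraMap_int_eq, eq_intCast, map_intCast, eq_intCast]

/-- **The place of `realSubfield` corresponding to a place `v` of `maximalRealSubfield F`.** -/
noncomputable def transportPlace (v : HeightOneSpectrum (𝓞 (maximalRealSubfield F))) :
    HeightOneSpectrum (𝓞 (realSubfield L F)) where
  asIdeal := v.asIdeal.map (integersAlgEquiv L F)
  isPrime := Ideal.map_isPrime_of_equiv (integersAlgEquiv L F)
  ne_bot := by
    intro h
    exact v.ne_bot ((Ideal.map_eq_bot_iff_of_injective (integersAlgEquiv L F).injective).mp h)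

/-- `transportPlace v` is the image of `v`. -/
theorem transportPlace_asIdeal (v : HeightOneSpectrum (𝓞 (maximalRealSubfield F))) :
    (transportPlace L F v).asIdeal = v.asIdeal.map (integersAlgEquiv L F) := rfl

/-- The contraction to `ℤ` is preserved: `(map e I).under ℤ = I.under ℤ`. -/
theorem under_map (I : Ideal (𝓞 (maximalRealSubfield F))) :
    (I.map (integersAlgEquiv L F)).under ℤ = I.under ℤ := by
  have hcomp : algebraMap ℤ (𝓞 (realSubfield L F)) =
      (integersAlgEquiv L F : 𝓞 (maximalRealSubfield F) →+* 𝓞 (realSubfield L F)).comp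
        (algebraMap ℤ (𝓞 (maximalRealSubfield F))) :=
    Subsingleton.elim _ _
  rw [Ideal.under, Ideal.under, hcomp, ← Ideal.comap_comap]
  congr 1
  exact Ideal.comap_map_of_bijective _ (integersAlgEquiv L F).bijective

variable (p : ℕ) [hp : Fact p.Prime]

omit hp in
/-- `transportPlace v` lies over `(p)` when `v` does. -/
theorem liesOver_transportPlace (v : HeightOneSpectrum (𝓞 (maximalRealSubfield F)))
    [hv : v.asIdeal.LiesOver (span {(p : ℤ)})] :
    (transportPlace L F v).asIdeal.LiesOver (span {(p : ℤ)}) :=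
  ⟨by rw [transportPlace_asIdeal, under_map]; exact hv.over⟩

/-- `(p)` is a maximal ideal of `ℤ`. -/
theorem isMaximal_span_prime : (span {(p : ℤ)}).IsMaximal :=
  PrincipalIdealRing.isMaximal_of_irreducible (Nat.prime_iff_prime_int.mp hp.out).irreducible

/-- **The residue degree is preserved by the transport**: `f(transportPlace v / p) = f(v/p)` (Mathlib's
`inertiaDeg'_map_eq` along the `ℤ`-algebra isomorphism, both primes read through `inertiaDeg'_eq_inertiaDeg`). -/
theorem inertiaDeg_transportPlace (v : HeightOneSpectrum (𝓞 (maximalRealSubfield F)))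
    [hv : v.asIdeal.LiesOver (span {(p : ℤ)})] :
    (transportPlace L F v).asIdeal.inertiaDeg ℤ = v.asIdeal.inertiaDeg ℤ := by
  haveI := isMaximal_span_prime p
  haveI := liesOver_transportPlace L F p v
  haveI : v.asIdeal.IsMaximal := v.isPrime.isMaximal v.ne_bot
  haveI : (transportPlace L F v).asIdeal.IsMaximal :=
    (transportPlace L F v).isPrime.isMaximal (transportPlace L F v).ne_bot
  rw [← Ideal.inertiaDeg'_eq_inertiaDeg (span {(p : ℤ)}) v.asIdeal,
    ← Ideal.inertiaDeg'_eq_inertiaDeg (span {(p : ℤ)}) (transportPlace L F v).asIdeal, transportPlace_asIdeal]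
  exact Ideal.inertiaDeg'_map_eq (span {(p : ℤ)}) v.asIdeal (integersAlgEquiv L F)

end Transport

section Cyclotomic

variable (m : ℕ) [NeZero m] (L : Type*) [Field L] [NumberField L] [IsCyclotomicExtension {m} ℚ L] [IsCMField L]
  (F : IntermediateField ℚ L) [IsCMField F]
variable (p : ℕ) [hp : Fact p.Prime] (hpm : p.Coprime m)
  (v : HeightOneSpectrum (𝓞 (maximalRealSubfield F))) [hv : v.asIdeal.LiesOver (span {(p : ℤ)})]

include hpm hv in
/-- **`f(v/p) = ord(p · ⟨H_F, −1⟩)` FOR EVERY PLACE `v` OF `maximalRealSubfield F` ABOVE `p ∤ m`** — the single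
formula of file 308 on the cell's own places (the transport preserves the residue degree). -/
theorem inertiaDeg_eq_orderOf_mk_sup :
    v.asIdeal.inertiaDeg ℤ =
      orderOf (QuotientGroup.mk (ZMod.unitOfCoprime p hpm) :
        (ZMod m)ˣ ⧸ (zmodSubgroup m L F ⊔ Subgroup.zpowers (-1))) := by
  haveI : IsGalois ℚ L := IsCyclotomicExtension.isGalois {m} ℚ L
  haveI : IsGalois ℚ F := T5CyclotomicUnramified.isGalois_intermediateField L m F
  haveI := liesOver_transportPlace L F p v
  rw [← inertiaDeg_transportPlace L F p v]
  exact inertiaDeg_realSubfield_eq_orderOf_mk m L F p hpm (transportPlace L F v).asIdeal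

include hpm hv in
/-- **`N(v) = p^{ord(p · ⟨H_F, −1⟩)}`**: the `q` of the record's local pair at `v`, in one formula. -/
theorem absNorm_eq_pow_orderOf_mk_sup :
    Ideal.absNorm v.asIdeal =
      p ^ orderOf (QuotientGroup.mk (ZMod.unitOfCoprime p hpm) :
        (ZMod m)ˣ ⧸ (zmodSubgroup m L F ⊔ Subgroup.zpowers (-1))) := by
  rw [← inertiaDeg_eq_orderOf_mk_sup m L F p hpm v]
  exact (Ideal.pow_inertiaDeg p v.asIdeal).symm

include hpm hv in
/-- **THE DICTIONARY BETWEEN THE TWO READINGS**, proved through number theory: for a prime `𝔭` of `F` above `v`,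
`ord(p · ⟨H_F, −1⟩) = ord(p · H_F) / 2` if `(−1) · H_F ∈ ⟨p · H_F⟩` and `= ord(p · H_F)` otherwise (file 300's two
regimes read against the single formula). -/
theorem orderOf_mk_sup_eq (𝔭 : Ideal (𝓞 F)) [h𝔭 : 𝔭.IsPrime] [h𝔭p : 𝔭.LiesOver (span {(p : ℤ)})]
    [hPv : 𝔭.LiesOver v.asIdeal] :
    orderOf (QuotientGroup.mk (ZMod.unitOfCoprime p hpm) :
        (ZMod m)ˣ ⧸ (zmodSubgroup m L F ⊔ Subgroup.zpowers (-1))) =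
      if (QuotientGroup.mk (-1) : (ZMod m)ˣ ⧸ zmodSubgroup m L F) ∈
          Subgroup.zpowers (QuotientGroup.mk (ZMod.unitOfCoprime p hpm)) then
        orderOf (QuotientGroup.mk (ZMod.unitOfCoprime p hpm) : (ZMod m)ˣ ⧸ zmodSubgroup m L F) / 2
      else orderOf (QuotientGroup.mk (ZMod.unitOfCoprime p hpm) : (ZMod m)ˣ ⧸ zmodSubgroup m L F) := by
  rw [← inertiaDeg_eq_orderOf_mk_sup m L F p hpm v]
  exact inertiaDeg_under_eq m L F p hpm 𝔭 v

end Cyclotomic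

end Summit.Ventures.HodgeRepro2.T5CyclotomicSubfieldRealSubfieldPlaces
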